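import Summits.BirchSwinnertonDyer.BirchSwinnertonDyer.Theorems.CongruentShaFreeCutKatoKummerLogTorsion
import Literature.NumberTheory.EllipticCurves.Kato2004.LocPKernelRankOne
import HarnessLib

set_option linter.dupNamespace false
set_option autoImplicit false

/-! # Reading (3.1″) of the Kato–zeta / Perrin-Riou road — the registered stub `stub_reading31b` of BOTH
# lines `kato-zeta-perrin-riou` (stmt-BirchSwinnertonDyer-19080 v1b; stmt-BirchSwinnertonDyer-19160 v1b proposal)
# — PROVED for every `W` and every `p` MODULO ONE named fact, `Kato2004.locP_kernel_isTorsion_of_rankOne`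

Cell `bsd-cn100`, prover seat `bsd-cn100-s2b-c3` (g6). THEOREMS ONLY; Theses-free (imports this seat's
plumbing `CongruentShaFreeCutKatoKummerLogTorsion` — v2 pin + the `b2b-bsdres` local logarithm — and the
Literature fact file `Kato2004/LocPKernelRankOne`). HONEST FRAMING: conditional on the displayed named fact
(Kato §14.1 + (14.9.3) read in the rank-one `Ш[p^∞]`-finite case: «`loc_p` on `H¹(ℤ[1/p], T_pW)` has
torsion kernel»; printed instance [ABS] App. A §10.1.3); nothing about crux B of either route, the
congruent number problem, Sylvester's problem or BSD is proved. PARTITION: none — RANK axis.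

## The argument ([ABS] §10.1.3 «Since `Sel_st(E)` is finite, it further follows that `0 ≠ loc_p(z_E)`»,
## run backwards on the tree's finite-level Kummer currency)

Let `pin : KatoDescentDatumPinH2 W p D`, `a := D.ι [D.z] ∈ D.A`, `y := toH1 (eA a) ∈ H¹(ℤ[1/p], T_pW)`
(integral: `toH1_mem`), `pin.katoClass = layerZeroToTop y`. Suppose `rank W(ℚ) = 1`, `Ш(W)[p^∞]` finite,
`p^m · a ≠ 0` for all `m` (the road's (K)+(3.1′) output), and `HasLocPKummerLog W p pin.katoClass t`.
If `t = 0`: the Kummer witness `Q ∈ E(ℚ_p)` has `log_ω(Q) = 0`, hence is TORSION (tree theorem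
`Additive.LocalLog.padicLog_eq_zero_iff`, AEC IV.6.4), so `loc_p(N·y) ≡ 0 (mod p^k)` for all `k` and some
`N ≠ 0` (`exists_forall_locModPk_nsmul_eq_zero_of_hasLocPKummerLog_zero`); the FACT gives `p^j·(N·y) = 0`;
the pin transport (`exists_pow_nsmul_eq_zero_of_pin`: `toH1`, `eA` injective, prime-to-`p` part of `N` a unit
of `Λ`) gives `p^m · a = 0` — contradiction. So `t ≠ 0`.

* `reading31b_of_fact` — ANY `W`, ANY `p`, any v2 pin.
* `reading31b_two_of_fact` — the registered `stub_reading31b` of 19080's v1b (`(E_n, 2)`), token for token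
  after the fact binder.
* `reading31b_three_of_fact` — the `stub_reading31b` of the 19160 v1b proposal (`(W, 3)`, `j(W) = 0`),
  token for token after the fact binder.
So on both items the plan can fold `locP_kernel_isTorsion_of_rankOne` into the citation-borne
`stub_refereedInputs` and PROVE `reading31b` in-skeleton (as was done for `reading31` with
`finite_descentCokernel_of_rankOne`), leaving {refereedInputs, readingRK, prFormula} — and {refereedInputs,
prFormula} once bsd-cn100-ty's `readingRK_of_facts` lands: crux B ⟸ citation-borne facts + ONE research
statement, on the Kato–zeta road too.

References: [AlpogeBhargavaShnidman2022] App. A §10.1.2–§10.1.3 (pp. 33–34); [Kato2004Asterisque] §14.1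
(p. 235), §14.9 (14.9.3) (p. 240), §14.14 (14.14.1) (p. 243); [SilvermanAEC2009] IV.6.4, VII.6.3, VIII.§2;
[BlochKato1990] Ex. 3.11.
-/

noncomputable section

open scoped Classical

namespace Summit.BirchSwinnertonDyer.BirchSwinnertonDyer.Theorems.CongruentShaFreeCutKatoReading31b

open WeierstrassCurve Field Literature.NumberTheory.EllipticCurves
  Literature.NumberTheory.EllipticCurves.Kato2004 Literature.NumberTheory.EllipticCurves.IwasawaAlgebra
  Literature.NumberTheory.EllipticCurves.Kato2004.EulerSystemValues
  Literature.NumberTheory.GaloisRepresentations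
open Summit.BirchSwinnertonDyer.Rank1Residual.Additive (KatoDescentDatum)
open Summit.BirchSwinnertonDyer.BirchSwinnertonDyer.Theorems.CongruentShaFreeCutKatoDescentDatumOfH2
open Summit.BirchSwinnertonDyer.BirchSwinnertonDyer.Theorems.CongruentShaFreeCutKatoKummerLogTorsion

/-! ## §1 Any `W`, any `p` -/

section Generic

variable {W : WeierstrassCurve ℚ} [W.IsElliptic] [W.IsGloballyMinimal] {p : ℕ} [Fact p.Prime]
  [ContinuousSMul ℤ_[p] (W.tateModule p)] {D : KatoDescentDatum p}

/-- **Reading (3.1″) on a v2-pinned datum, from the named fact `locP_kernel_isTorsion_of_rankOne`**: if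
`rank W(ℚ) = 1`, `Ш(W)[p^∞]` is finite and the pinned image `D.ι [D.z]` of the zeta element is not
`ℤ_p`-torsion (`∀ m, p^m · ι[z] ≠ 0`), then every Kummer logarithm `t` of the pinned Kato class
(`HasLocPKummerLog W p pin.katoClass t`) is NON-ZERO. Proof in the module docstring: `t = 0` ⟹ the Kummer
witness is torsion (AEC IV.6.4, tree theorem) ⟹ `loc_p(N·ι[z]) = 0` at every level ⟹ (FACT) `p^j·N·ι[z] = 0`
in `H¹(ℤ[1/p], T_pW)` ⟹ (pin transport) `p^m · ι[z] = 0` in `D.A`. CONDITIONAL on the displayed fact; credits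
nothing. [cite: AlpogeBhargavaShnidman2022, App. A §10.1.3 (p. 34)] [cite: Kato2004Asterisque, §14.9 (14.9.3) (p. 240) and §14.14 (14.14.1) (p. 243)]
[cite: SilvermanAEC2009, IV.6.4 and VII.6.3] -/
theorem reading31b_of_fact (h : locP_kernel_isTorsion_of_rankOne) (pin : KatoDescentDatumPinH2 W p D)
    (hrank : W.mordellWeilRank = 1) (hsha : Finite (AddCommGroup.primaryComponent W.sha p))
    (hz : ∀ m : ℕ, p ^ m • D.ι (Submodule.Quotient.mk D.z) ≠ 0) (t : ℚ_[p])
    (ht : HasLocPKummerLog W p pin.katoClass t) : t ≠ 0 := by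
  rintro rfl
  obtain ⟨N, hN, hk⟩ :=
    exists_forall_locModPk_nsmul_eq_zero_of_hasLocPKummerLog_zero W p pin.katoClass ht
  -- the pinned class is `layerZeroToTop y` with `y = toH1 (eA (ι[z]))` integral
  have hy : N • pin.J.toH1 (pin.eA (D.ι (Submodule.Quotient.mk D.z))) ∈
      integralH1 (tateRep W p) p (pin.κ.layerSubgroup 0) :=
    nsmul_mem (pin.J.toH1_mem _) N
  have hk' : ∀ k : ℕ, locModPk W p k (layerZeroToTop W p pin.κ
      (N • pin.J.toH1 (pin.eA (D.ι (Submodule.Quotient.mk D.z))))) = 0 := by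
    intro k
    rw [map_nsmul]
    exact hk k
  obtain ⟨j, hj⟩ := h W p pin.κ _ hy hrank hsha hk'
  obtain ⟨m, hm⟩ := exists_pow_nsmul_eq_zero_of_pin pin hN hj
  exact hz m hm

end Generic

/-! ## §2 The registered shapes -/

/-- **`stub_reading31b` of 19080's registered line `kato-zeta-perrin-riou` v1b, modulo the named fact**
(signature after the fact binder = the registered stub token for token: `(E_n, 2)`, square-free `n`).
CONDITIONAL on the displayed fact; credits nothing by itself (the plan folds the fact into
`stub_refereedInputs` and proves the stub in-skeleton from this theorem).
[cite: AlpogeBhargavaShnidman2022, App. A §10.1.3 (p. 34)] [cite: Kato2004Asterisque, §14.9 (14.9.3) (p. 240)] -/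
theorem reading31b_two_of_fact (h : locP_kernel_isTorsion_of_rankOne) :
    ∀ ⦃n : ℕ⦄, Squarefree n →
      ∀ [(congruentNumberCurve n).IsElliptic] [(congruentNumberCurve n).IsGloballyMinimal]
        [ContinuousSMul ℤ_[2] ((congruentNumberCurve n).tateModule 2)]
        (D : KatoDescentDatum 2) (pin : KatoDescentDatumPinH2 (congruentNumberCurve n) 2 D),
        (congruentNumberCurve n).mordellWeilRank = 1 →
          Finite (AddCommGroup.primaryComponent (congruentNumberCurve n).sha 2) →
            (∀ m : ℕ, 2 ^ m • D.ι (Submodule.Quotient.mk D.z) ≠ 0) →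
              ∀ t : ℚ_[2], HasLocPKummerLog (congruentNumberCurve n) 2 pin.katoClass t → t ≠ 0 :=
  fun _ _ _ _ _ _ pin hrank hsha hz t ht ↦ reading31b_of_fact h pin hrank hsha hz t ht

/-- **`stub_reading31b` of the 19160 line `kato-zeta-perrin-riou` v1b (proposal of this seat), modulo the
named fact** (signature after the fact binder = that stub token for token: `W` globally minimal with
`j(W) = 0`, `p = 3`). CONDITIONAL on the displayed fact; credits nothing by itself.
[cite: AlpogeBhargavaShnidman2022, App. A §10.1.3 (p. 34)] [cite: Kato2004Asterisque, §14.9 (14.9.3) (p. 240)] -/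
theorem reading31b_three_of_fact (h : locP_kernel_isTorsion_of_rankOne) :
    ∀ (W : WeierstrassCurve ℚ) [W.IsElliptic] [W.IsGloballyMinimal]
      [ContinuousSMul ℤ_[3] (W.tateModule 3)] (D : KatoDescentDatum 3)
      (pin : KatoDescentDatumPinH2 W 3 D), W.j = 0 → W.mordellWeilRank = 1 →
        Finite (AddCommGroup.primaryComponent W.sha 3) →
          (∀ m : ℕ, 3 ^ m • D.ι (Submodule.Quotient.mk D.z) ≠ 0) →
            ∀ t : ℚ_[3], HasLocPKummerLog W 3 pin.katoClass t → t ≠ 0 :=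
  fun _ _ _ _ _ pin _ hrank hsha hz t ht ↦ reading31b_of_fact h pin hrank hsha hz t ht

end Summit.BirchSwinnertonDyer.BirchSwinnertonDyer.Theorems.CongruentShaFreeCutKatoReading31b

end
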